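import Summits.Ventures.AbcSig.Rows.XTemplateAB2
import Summits.Ventures.AbcSig.Levels.N5504
import Summits.Ventures.AbcSig.Levels.N86
import Summits.Ventures.AbcSig.Levels.N86M6X

/-!
# Venture AbcSig — ROW `C2aL43A1V2AB`: `43^m·xⁿ + 2·yⁿ = z²`, class `a = 1`, over NORM-FORM level certificates (GENERATED by p-lean g4 `gen4/c2arow.py`)

HONEST FRAMING. A row of a COMPUTATION cell (`pub-abcsig`); a CONDITIONAL theorem, no claim on ABC or any summit.
Hypotheses: `BS04Package` (CITED: [BS04] Lemma 3.3 + (3.1) + Lemma 4.2); `DataComplete` at the levels 128·43 = 5504 (norm-form level file, `Sieve/CharpolyCert.lean`, with the COMPUTED `RefinesCPSymAll 5504`) and 2·43 = 86 (ordinary tree certificates); `EisPackage` (CITED) + `Refines` (COMPUTED) for the module-M6 residues of level 86 discharged IN THE KERNEL (`Levels/N86M6X.lean`);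
and the listed per-orbit exclusions `hX_…` (CITED: the row of record's module M8 'level-drop by congruence' closures, lead RULING M8 /
lit/M8-PIN.md, engine-2 + p1 second implementation + referee third reading — nothing of M8 is checked here).
Exponent range: prime `n ≥ 11`, `n ≠ 43`; `B = 2·43^m` with `1 ≤ m < n` (RULING H1 reduced exponents).
CITED (module M8 'level-drop by congruence', 32/32 referee third reading): the four degree-8 orbits 5504.9–.12 at n = 19 (congruent modulo (19, θ − 2) / (19, θ − 17) to level-43 data to the Sturm bound). Level 86: 86.2 @ 11 is DISCHARGED IN THE KERNEL by the cell's module M6 (Eisenstein) certificate (Levels/N86M6X.lean). v2 residual: none (v1: {19}).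
Row of record: `census/rows/C2a/C2a-l43-a1.md` (v2 = superseding revision; sha16 `e44ba8d469c2a235`; v2 R8-signed 2026-08-23T01:59Z by referee (ref-g23), RULING PIN-FALLBACK / lit M8-PIN countersigned).
-/

namespace Summit.Ventures.AbcSig

/-- Row `C2aL43A1V2AB`: class `a = 1`, second distribution, prime `n ≥ 11`, `n ≠ 43`; conditional on the named hypotheses. -/
theorem xrow_C2aL43A1V2AB (M : NewformModel) (hP : M.BS04Package)
    (hE : M.EisPackage)
    (hR_orbit_86_2 : M.Refines 86 orbit_86_2 m6X_86_2)
    (hD86 : M.DataComplete 86 level86Orbits)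
    (hD5504 : M.DataComplete 5504 level5504Orbits) (hCP5504 : M.RefinesCPSymAll 5504 level5504CP)
    (n : ℕ) (hn : n.Prime) (hmin : 11 ≤ n) (hnℓ : n ≠ 43) (m : ℕ) (hm : 1 ≤ m) (hmn : m < n)
    (hX_orbit_5504_9 : n ∈ ([19] : List ℕ) → M.Excludes 5504 orbit_5504_9
      (famAB (43 ^ m) (2 ^ 1) n (fun _ _ => True)))
    (hX_orbit_5504_10 : n ∈ ([19] : List ℕ) → M.Excludes 5504 orbit_5504_10
      (famAB (43 ^ m) (2 ^ 1) n (fun _ _ => True)))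
    (hX_orbit_5504_11 : n ∈ ([19] : List ℕ) → M.Excludes 5504 orbit_5504_11
      (famAB (43 ^ m) (2 ^ 1) n (fun _ _ => True)))
    (hX_orbit_5504_12 : n ∈ ([19] : List ℕ) → M.Excludes 5504 orbit_5504_12
      (famAB (43 ^ m) (2 ^ 1) n (fun _ _ => True)))
    (x y z : ℤ) (hxy1 : x * y ≠ 1) (hxy2 : x * y ≠ -1) : ¬ IsPrimitiveSolution (43 ^ m) (2 ^ 1) 1 n x y z := by
  have hℓ : Nat.Prime 43 := by norm_num
  have h7 : 7 ≤ n := by omega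
  exact xrowC2aAB_a1 43 hℓ (by norm_num) M hP n hn h7 hnℓ hD5504 hD86 m hm hmn
    (level5504_sieve M hP hCP5504 n hn h7 (fun o => M.Excludes 5504 o
      (famAB (43 ^ m) (2 ^ 1) n (fun _ _ => True)) ∨ M.ExcludesStd 5504 o n) (fun _ h => Or.inr h) (fun hmem => by
      obtain rfl : n = 7 := by simpa using hmem
      omega) (fun hmem => by
      obtain rfl : n = 7 := by simpa using hmem
      omega) (fun hmem => by
      obtain rfl : n = 7 := by simpa using hmem
      omega) (fun hmem => by
      obtain rfl : n = 7 := by simpa using hmem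
      omega) (fun hmem => by
      obtain rfl : n = 19 := by simpa using hmem
      exact Or.inl (hX_orbit_5504_9 (by simp))) (fun hmem => by
      obtain rfl : n = 19 := by simpa using hmem
      exact Or.inl (hX_orbit_5504_10 (by simp))) (fun hmem => by
      obtain rfl : n = 19 := by simpa using hmem
      exact Or.inl (hX_orbit_5504_11 (by simp))) (fun hmem => by
      obtain rfl : n = 19 := by simpa using hmem
      exact Or.inl (hX_orbit_5504_12 (by simp))) (fun hmem => by
      obtain rfl : n = 7 := by simpa using hmem
      omega) (fun hmem => by
      obtain rfl : n = 7 := by simpa using hmem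
      omega) (fun hmem => by
      obtain rfl : n = 7 := by simpa using hmem
      omega) (fun hmem => by
      obtain rfl : n = 7 := by simpa using hmem
      omega))
    (level86_sieve n hn h7 (fun o => M.Excludes 86 o
      (famAB (43 ^ m) (2 ^ 1) n (fun _ _ => True)) ∨ M.ExcludesStd 86 o n) (fun hmem => by
      obtain rfl : n = 7 := by simpa using hmem
      omega) (fun hmem => by
      obtain rfl : n = 11 := by simpa using hmem
      exact Or.inr (m6c_86_2_n11_excludes M hE hR_orbit_86_2)))
    x y z hxy1 hxy2

end Summit.Ventures.AbcSig
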